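import Mathlib.Analysis.Calculus.InverseFunctionTheorem.ContDiff
import Mathlib.Analysis.Normed.Operator.BoundedLinearMaps
import Mathlib.Analysis.Complex.RealDeriv
import Mathlib.LinearAlgebra.Complex.FiniteDimensional
import Mathlib.LinearAlgebra.FiniteDimensional.Basic
import Literature.Topology.FourManifolds.SurfaceSmoothingAtlas
import HarnessLib

/-!
# Adapted charts along a level curve (surface-smoothing programme, P2 core)

Topic `Literature/Topology/FourManifolds` (the `n = 2` leaf of
`Literature.Topology.FourManifolds.exists_chartedSpace_isManifold_of_le_three`, spc4.S33, seat 1 /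
approach B "smooth-domain seam"; sequel to `SurfaceSmoothingAtlas.lean`). **Everything is proved;
no named fact is introduced** (the only definitions are the explicit straightening map
`straighten` and its differential `straightenDeriv`).

The seam construction glues the standard structure of a planar disc to a given `C^∞` structure
(a `PlanarAtlas`) along the boundary `{u = c}` of a sublevel domain `{u ≤ c}` of a smooth
function `u` at a regular value `c`. This file supplies the charts in which that boundary is a
straight line and the domain a half plane:

* `exists_straighteningChart` — **straightening a regular level curve in the plane**: for
  `g : ℂ → ℝ` of class `C^∞` on an open `O ∋ p` with `dg(p) ≠ 0` there is an open partial
  homeomorphism `ψ` of `ℂ`, `p ∈ ψ.source ⊆ O`, smooth with smooth inverse, given by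
  `Ψ w = dg(p)(i (w - p)) + (g w - g p) i` (`straighten`), so that `im (ψ w) = g w - g p`
  (inverse function theorem: `dΨ(p)` is injective because a nonzero real functional cannot kill
  both `v` and `i v`, `eq_zero_of_apply_eq_zero_of_apply_I_mul_eq_zero`).
* `IsSmoothCompat.trans_right` — composing a planar chart with a `C^∞` diffeomorphism of the
  plane preserves compatibility.
* `exists_adaptedChart` — **adapted charts of a planar atlas**: if `u` is `C^∞` in a chart
  `e ∈ 𝒜` with nonzero differential at `e p`, there is a chart `e'` around `p`, inside
  `e.source`, compatible with every chart of `𝒜`, in which `u x = im (e' x) + u p`.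

## References

* J. Milnor, *Topology from the Differentiable Viewpoint* (1965), §1, Lemma 1 p. 11 (regular
  level sets via the inverse function theorem). [MilnorTDV1965]
* A. Hatcher, *The Kirby torus trick for surfaces*, arXiv:1312.3518 (2013) (context).
-/

noncomputable section

open Set Function
open scoped Manifold ContDiff Topology

namespace Literature.Topology.FourManifolds

namespace SurfaceSmoothing

/-! ## Adapted charts: straightening the level curves of a smooth function (P2 core) -/

section Straighten

open Complex

/-- The straightening map of a real function `g` at `p`, built from its differential `L = dg(p)`:
`Ψ w = L(i (w - p)) + (g w - g p) i`. Its level lines `im Ψ = const` are the level curves of `g`.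
[folklore] -/
def straighten (g : ℂ → ℝ) (p : ℂ) (w : ℂ) : ℂ :=
  ((fderiv ℝ g p (I * (w - p)) : ℝ) : ℂ) + ((g w - g p : ℝ) : ℂ) * I

/-- The imaginary part of the straightening map is `g - g p`. [folklore] -/
@[simp] theorem straighten_im (g : ℂ → ℝ) (p w : ℂ) : (straighten g p w).im = g w - g p := by
  simp [straighten]

/-- `Ψ p = 0`. [folklore] -/
@[simp] theorem straighten_self (g : ℂ → ℝ) (p : ℂ) : straighten g p p = 0 := by
  simp [straighten]

/-- A nonzero real vector and its multiple by `i` form a real basis of `ℂ`: a real-linear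
functional vanishing on both is zero. [folklore] -/
theorem eq_zero_of_apply_eq_zero_of_apply_I_mul_eq_zero {L : ℂ →L[ℝ] ℝ} {v : ℂ} (hv : v ≠ 0)
    (h1 : L v = 0) (h2 : L (I * v) = 0) : L = 0 := by
  -- every `w` is a real combination of `v` and `i v`: `w = (w / v).re • v + (w / v).im • (i v)`
  ext w
  have hw : w = ((w / v).re : ℂ) * v + ((w / v).im : ℂ) * (I * v) := by
    have : w = (w / v) * v := by rw [div_mul_cancel₀ w hv]
    conv_lhs => rw [this, ← Complex.re_add_im (w / v)]
    ring
  rw [hw, map_add]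
  have e1 : L (((w / v).re : ℂ) * v) = (w / v).re * L v := by
    rw [show ((w / v).re : ℂ) * v = (w / v).re • v by rw [Complex.real_smul]]; rw [map_smul, smul_eq_mul]
  have e2 : L (((w / v).im : ℂ) * (I * v)) = (w / v).im * L (I * v) := by
    rw [show ((w / v).im : ℂ) * (I * v) = (w / v).im • (I * v) by rw [Complex.real_smul]]
    rw [map_smul, smul_eq_mul]
  rw [e1, e2, h1, h2]
  simp

/-- The differential of the straightening map at a point `w` (where `g` is differentiable):
`v ↦ L(i v) + (dg(w) v) i`, `L = dg(p)`. [folklore] -/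
def straightenDeriv (g : ℂ → ℝ) (p w : ℂ) : ℂ →L[ℝ] ℂ :=
  Complex.ofRealCLM.comp ((fderiv ℝ g p).comp ((I : ℂ) • ContinuousLinearMap.id ℝ ℂ)) +
    (I : ℂ) • (Complex.ofRealCLM.comp (fderiv ℝ g w))

/-- Formula for the differential. [folklore] -/
theorem straightenDeriv_apply (g : ℂ → ℝ) (p w v : ℂ) :
    straightenDeriv g p w v = ((fderiv ℝ g p (I * v) : ℝ) : ℂ) + ((fderiv ℝ g w v : ℝ) : ℂ) * I := by
  simp [straightenDeriv, smul_eq_mul, mul_comm]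

/-- The straightening map has the expected derivative wherever `g` is differentiable. [folklore] -/
theorem hasFDerivAt_straighten {g : ℂ → ℝ} {p w : ℂ} (hg : DifferentiableAt ℝ g w) :
    HasFDerivAt (straighten g p) (straightenDeriv g p w) w := by
  have ha : HasFDerivAt (fun w : ℂ => I * (w - p)) ((I : ℂ) • ContinuousLinearMap.id ℝ ℂ) w :=
    ((hasFDerivAt_id (𝕜 := ℝ) w).sub_const p).const_mul I
  have h1 : HasFDerivAt (fun w : ℂ => ((fderiv ℝ g p (I * (w - p)) : ℝ) : ℂ))
      (Complex.ofRealCLM.comp ((fderiv ℝ g p).comp ((I : ℂ) • ContinuousLinearMap.id ℝ ℂ))) w :=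
    Complex.ofRealCLM.hasFDerivAt.comp w ((fderiv ℝ g p).hasFDerivAt.comp w ha)
  have hb : HasFDerivAt (fun w : ℂ => ((g w - g p : ℝ) : ℂ)) (Complex.ofRealCLM.comp (fderiv ℝ g w)) w :=
    Complex.ofRealCLM.hasFDerivAt.comp w (hg.hasFDerivAt.sub_const (g p))
  have h2 : HasFDerivAt (fun w : ℂ => ((g w - g p : ℝ) : ℂ) * I)
      ((I : ℂ) • (Complex.ofRealCLM.comp (fderiv ℝ g w))) w := hb.mul_const I
  exact h1.add h2

/-- **At `p` the differential of the straightening map is invertible** when `dg(p) ≠ 0`.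
[folklore] -/
theorem injective_straightenDeriv_self {g : ℂ → ℝ} {p : ℂ} (hg : fderiv ℝ g p ≠ 0) :
    Injective (straightenDeriv g p p) := by
  set L := fderiv ℝ g p with hL
  intro v w hvw
  rw [← sub_eq_zero] at hvw ⊢
  rw [← map_sub] at hvw
  set u := v - w with hu
  rw [straightenDeriv_apply] at hvw
  -- real and imaginary parts
  have h1 : L (I * u) = 0 := by
    have := congrArg Complex.re hvw
    simpa using this
  have h2 : L u = 0 := by
    have := congrArg Complex.im hvw
    simpa using this
  by_contra hne
  exact hg (eq_zero_of_apply_eq_zero_of_apply_I_mul_eq_zero hne h2 h1)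

/-- **The straightening chart.** Let `g : ℂ → ℝ` be `C^∞` on an open set `O ∋ p` with
`dg(p) ≠ 0`. Then there is an open partial homeomorphism `ψ` of `ℂ`, with `p ∈ ψ.source ⊆ O`,
which is a `C^∞` diffeomorphism onto its target, given by the straightening map, so that
`im (ψ w) = g w - g p`: in the chart `ψ` the level curves of `g` are horizontal lines and
`{g ≤ g p}` is the lower half plane. (Inverse function theorem.) [folklore] -/
theorem exists_straighteningChart {g : ℂ → ℝ} {O : Set ℂ} (hO : IsOpen O) {p : ℂ} (hp : p ∈ O)
    (hg : ContDiffOn ℝ ∞ g O) (hg' : fderiv ℝ g p ≠ 0) :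
    ∃ ψ : OpenPartialHomeomorph ℂ ℂ, p ∈ ψ.source ∧ ψ.source ⊆ O ∧ (∀ w, ψ w = straighten g p w) ∧
      ContDiffOn ℝ ∞ ψ ψ.source ∧ ContDiffOn ℝ ∞ ψ.symm ψ.target := by
  set Ψ := straighten g p with hΨ
  have hgp : ContDiffAt ℝ ∞ g p := hg.contDiffAt (hO.mem_nhds hp)
  -- smoothness of `Ψ` on `O`
  have hΨsm : ContDiffOn ℝ ∞ Ψ O := by
    have h1 : ContDiffOn ℝ ∞ (fun w : ℂ => ((fderiv ℝ g p (I * (w - p)) : ℝ) : ℂ)) O :=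
      (Complex.ofRealCLM.contDiff.comp ((fderiv ℝ g p).contDiff.comp
        ((contDiff_const.mul (contDiff_id.sub contDiff_const))))).contDiffOn
    have h2 : ContDiffOn ℝ ∞ (fun w : ℂ => ((g w - g p : ℝ) : ℂ) * I) O :=
      (Complex.ofRealCLM.contDiff.comp_contDiffOn (hg.sub contDiffOn_const)).mul contDiffOn_const
    exact h1.add h2
  have hΨp : ContDiffAt ℝ ∞ Ψ p := hΨsm.contDiffAt (hO.mem_nhds hp)
  -- the invertible differential at `p`
  set D := straightenDeriv g p p with hD
  have hDinj : Injective D := injective_straightenDeriv_self hg'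
  have hDsurj : Surjective D := LinearMap.injective_iff_surjective.1 hDinj
  set Deq : ℂ ≃L[ℝ] ℂ := ContinuousLinearEquiv.ofBijective D (LinearMap.ker_eq_bot.2 hDinj)
    (LinearMap.range_eq_top.2 hDsurj) with hDeq
  have hDeqcoe : (Deq : ℂ →L[ℝ] ℂ) = D := ContinuousLinearEquiv.coe_ofBijective _ _ _
  have hder : HasFDerivAt Ψ (Deq : ℂ →L[ℝ] ℂ) p := by
    rw [hDeqcoe]; exact hasFDerivAt_straighten (hgp.differentiableAt (by simp))
  -- the local inverse
  set ψ₀ := hΨp.toOpenPartialHomeomorph Ψ hder (by simp) with hψ₀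
  have hψ₀coe : (ψ₀ : ℂ → ℂ) = Ψ := hΨp.toOpenPartialHomeomorph_coe hder (by simp)
  have hpψ₀ : p ∈ ψ₀.source := hΨp.mem_toOpenPartialHomeomorph_source hder (by simp)
  -- restrict to where `g` is smooth and the differential of `Ψ` is invertible
  set G : Set ℂ := {w | fderiv ℝ Ψ w ∈ range ((↑) : (ℂ ≃L[ℝ] ℂ) → ℂ →L[ℝ] ℂ)} with hG
  have hOG : IsOpen (O ∩ G) :=
    (hΨsm.continuousOn_fderiv_of_isOpen hO (by simp)).isOpen_inter_preimage hO ContinuousLinearEquiv.isOpen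
  have hpG : p ∈ O ∩ G := ⟨hp, ⟨Deq, by rw [hder.fderiv]⟩⟩
  set ψ := ψ₀.restrOpen (O ∩ G) hOG with hψ
  refine ⟨ψ, ⟨hpψ₀, hpG⟩, fun w hw => hw.2.1, fun w => by rw [OpenPartialHomeomorph.coe_restrOpen, hψ₀coe], ?_, ?_⟩
  · rw [OpenPartialHomeomorph.coe_restrOpen, hψ₀coe]
    exact hΨsm.mono fun w hw => hw.2.1
  · intro y hy
    have hx : ψ.symm y ∈ ψ.source := ψ.map_target hy
    have hxO : ψ.symm y ∈ O := hx.2.1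
    obtain ⟨E, hE⟩ := hx.2.2
    have hderx : HasFDerivAt ψ (E : ℂ →L[ℝ] ℂ) (ψ.symm y) := by
      rw [OpenPartialHomeomorph.coe_restrOpen, hψ₀coe, hE]
      exact ((hΨsm.contDiffAt (hO.mem_nhds hxO)).differentiableAt (by simp)).hasFDerivAt
    have hsmx : ContDiffAt ℝ ∞ ψ (ψ.symm y) := by
      rw [OpenPartialHomeomorph.coe_restrOpen, hψ₀coe]
      exact hΨsm.contDiffAt (hO.mem_nhds hxO)
    exact (ψ.contDiffAt_symm hy hderx hsmx).contDiffWithinAt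

end Straighten

/-! ### Adapted charts of a planar atlas along a level curve -/

section Adapted

/-- Composing a planar chart on the right with a `C^∞` diffeomorphism of the plane (an open partial
homeomorphism `ψ` of `ℂ` smooth in both directions) preserves compatibility. [folklore] -/
theorem IsSmoothCompat.trans_right {X : Type*} [TopologicalSpace X] {e e'' : OpenPartialHomeomorph X ℂ}
    (h : IsSmoothCompat e e'') {ψ : OpenPartialHomeomorph ℂ ℂ} (hψ : ContDiffOn ℝ ∞ ψ ψ.source)
    (hψ' : ContDiffOn ℝ ∞ ψ.symm ψ.target) : IsSmoothCompat (e.trans ψ) e'' := by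
  refine isSmoothCompat_of_contDiffOn ?_ ?_
  · -- `e'' ∘ (e.trans ψ).symm = (e'' ∘ e.symm) ∘ ψ.symm`
    have hcomp : ContDiffOn ℝ ∞ ((e'' ∘ e.symm) ∘ ψ.symm)
        ((e.trans ψ).target ∩ (e.trans ψ).symm ⁻¹' e''.source) := by
      refine h.contDiffOn.comp (hψ'.mono ?_) ?_
      · rintro z ⟨hz, -⟩
        rw [OpenPartialHomeomorph.trans_target] at hz
        exact hz.1
      · rintro z ⟨hz, hz'⟩
        rw [OpenPartialHomeomorph.trans_target, mem_inter_iff, mem_preimage] at hz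
        exact ⟨hz.2, hz'⟩
    exact hcomp.congr fun z _ => rfl
  · -- `(e.trans ψ) ∘ e''.symm = ψ ∘ (e ∘ e''.symm)`
    have hcomp : ContDiffOn ℝ ∞ (ψ ∘ (e ∘ e''.symm))
        (e''.target ∩ e''.symm ⁻¹' (e.trans ψ).source) := by
      refine hψ.comp (h.symm.contDiffOn.mono ?_) ?_
      · rintro z ⟨hz, hz'⟩
        rw [mem_preimage, OpenPartialHomeomorph.trans_source] at hz'
        exact ⟨hz, hz'.1⟩
      · rintro z ⟨-, hz'⟩
        rw [mem_preimage, OpenPartialHomeomorph.trans_source, mem_inter_iff, mem_preimage] at hz'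
        exact hz'.2
    exact hcomp.congr fun z _ => rfl

/-- **Adapted charts.** Let `𝒜` be a planar atlas on `W ⊆ X`, `e ∈ 𝒜` a chart, `u : X → ℝ` a function
which is `C^∞` in the chart `e` (`u ∘ e.symm` is `C^∞` on `e.target`) with nonzero differential at
`e p`, `p ∈ e.source`. Then there is a chart `e'` with `p ∈ e'.source ⊆ e.source`, compatible with
every chart of `𝒜`, in which `u` is the height: `u x = im (e' x) + u p` on `e'.source`. (The chart
`e` followed by the straightening chart of `u ∘ e.symm`.) [folklore] -/
theorem exists_adaptedChart {X : Type*} [TopologicalSpace X] {W : Set X} (𝒜 : PlanarAtlas X W)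
    {e : OpenPartialHomeomorph X ℂ} (he : e ∈ 𝒜.charts) {p : X} (hp : p ∈ e.source) {u : X → ℝ}
    (hu : ContDiffOn ℝ ∞ (u ∘ e.symm) e.target) (hu' : fderiv ℝ (u ∘ e.symm) (e p) ≠ 0) :
    ∃ e' : OpenPartialHomeomorph X ℂ, p ∈ e'.source ∧ e'.source ⊆ e.source ∧
      (∀ e'' ∈ 𝒜.charts, IsSmoothCompat e' e'') ∧ IsSmoothCompat e' e' ∧
      ∀ x ∈ e'.source, u x = (e' x).im + u p := by
  obtain ⟨ψ, hpψ, hψO, hψeq, hψsm, hψsm'⟩ :=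
    exists_straighteningChart e.open_target (e.map_source hp) hu hu'
  refine ⟨e.trans ψ, ?_, ?_, fun e'' he'' => (𝒜.compat e he e'' he'').trans_right hψsm hψsm', ?_, ?_⟩
  · rw [OpenPartialHomeomorph.trans_source]; exact ⟨hp, hpψ⟩
  · rw [OpenPartialHomeomorph.trans_source]; exact inter_subset_left
  · exact isSmoothCompat_self _
  · intro x hx
    rw [OpenPartialHomeomorph.trans_source] at hx
    show u x = (ψ (e x)).im + u p
    rw [hψeq, straighten_im]
    simp only [comp_apply, e.left_inv hp, e.left_inv hx.1]
    ring

end Adapted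

end SurfaceSmoothing

end Literature.Topology.FourManifolds
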